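import Mathlib
import HarnessLib
import Literature.MathematicalPhysics.QuantumLattice.TorusShellCounting
import Summits.HubbardSuperconductivity.HubbardSuperconductivity.Theorems.KLProgrammeKLRegimeScaleZeroDetBoundFreeBand

/-!
# Route `KLProgramme`, ENGINE child (stmt-…-20437), scale `0` at the bare frame: the determinant / replica-Gram constant is `√16 = 4` on `klWindowC`
# (sharpening of `…ScaleZeroDetBoundFreeBand`'s `√46` by the tree's own free-band shell count `Literature/…/TorusShellCounting`)

Cell gate-hubbard-kl, seat p1 (g18); located item #22 «(C)-SCALE0-NATURAL» (stub (C) n = 0).  `…ScaleZeroDetBoundFreeBand` counted the free Fermi annulus with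
Salmhofer's generic line pieces (`card_le_of_coordFloor`, `(Kc,c₀,N) = (2,16/25,40)`: `c₁ ≈ 80`).  The tree ALREADY holds the natural two-branch count for the
free band: `TorusShellCounting.card_torusShell_le` — `#{k⃗ : |ε_L(k⃗) − μ| < η} ≤ 4L(ηL/(2π√(d₀/8)) + 1)` for `μ` at distance `≥ d₀` from `{−4, 0, 4}` and
`0 < η ≤ d₀/2` (concavity of `sin` on `[0,π]` + mean value, per row, two signs, two directions).  On `klWindowC = [−1.05, −0.15]` take `d₀ = 0.15`
(`η ≤ e₀ = 1/32 ≤ 0.075`): `c₁ = 2/(π√(0.15/8)) ≈ 4.65`, `c₂ = 4`, hence through `InfraredCutoffGramConstantLargeVolume` the infrared Gram constant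
`κ_IR² ≤ (20/π)·c₁/32 + 10⁻⁴ = 40/(32π²√(0.15/8)) + 10⁻⁴ ≤ 0.93 ≤ 1` once `2¹⁰β² ≤ L`, and the scale-`0` determinant constant at the bare frame is
**`δ₀ = √(2·(7+1)) = 4`** (`δ₀² = 16`; this morning: 46 here-before, 728 frame-uniform, 12108 / 3213478 of record):

* `card_freeLevel_lt_le_sharp` (the count in `c₁ηL² + c₂L` form), `infraredGram_free_scaleZero_le_one` (`≤ 1`);
* **`isDetBoundedR_scaleZero_free_sharp` / `isGramBoundedR_scaleZero_free_sharp`** (`√(2·(7+1))`, `μ ∈ klWindowC`, `klBetaMin ≤ β`, `2¹⁰β² ≤ L`, every `M ≥ 1`)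
  and the **`…_sharp_klEngL₃`** twins under the stub binder `klEngL₃ β U ≤ L`.

Every tail door of `…ScaleZeroTwoLegTail3/…TailN` is stated at `√46` through `isGramBoundedR_scaleZero_free_klEngL₃`; a consumer wanting the factor
`(16/46)³ ≈ 1/24` (n₀ = 3) or `(16/46)⁴ ≈ 1/68` (n₀ = 4) re-runs the generic doors `twoLeg_wsum_tail3_le / twoLeg_wsum_tailN_le` with this constant.
No definition; everything PROVED. [folklore]
-/

noncomputable section

-- the tree's namespace `Summit.<Summit>.<Problem>.Theorems` repeats the summit name by design (D-0017)
set_option linter.dupNamespace false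

namespace Summit.HubbardSuperconductivity.HubbardSuperconductivity.Theorems.KLRegimeSplit

open Real Finset Literature.MathematicalPhysics.QuantumLattice Literature.Probability.LatticeModels
open Literature.MathematicalPhysics.QuantumLattice.FermiRG

variable {L : ℕ} [NeZero L]

/-- **The free-band level count on the window, natural constant** (`TorusShellCounting.card_torusShell_le` at `d₀ = 0.15`): for `μ ∈ klWindowC`,
`0 < η ≤ klE0`: `#{k⃗ : |ξ_μ(k⃗)| < η} ≤ (2/(π√(0.15/8)))·η·L² + 4·L` (`ξ_μ = nambuXiCT L μ 0 = ε_L − μ`). -/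
theorem card_freeLevel_lt_le_sharp {μ : ℝ} (hμ : μ ∈ klWindowC) {η : ℝ} (hη : 0 < η) (hηe : η ≤ klE0) :
    (((univ : Finset (TorusSite 2 L)).filter fun k => |nambuXiCT L μ 0 k| < η).card : ℝ) ≤
      2 / (π * Real.sqrt (0.15 / 8)) * η * (L : ℝ) ^ 2 + 4 * L := by
  rcases hμ with ⟨hμ1, hμ2⟩
  have hηd : η ≤ (0.15 : ℝ) / 2 := hηe.trans (by norm_num [klE0])
  have h := card_torusShell_le (L := L) (μ := μ) (d₀ := 0.15) (by linarith) (by linarith) hη hηd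
  have hset : ((univ : Finset (TorusSite 2 L)).filter fun k => |nambuXiCT L μ 0 k| < η) =
      (univ.filter fun k : TorusSite 2 L => |torusBand L k - μ| < η) := by
    refine Finset.filter_congr fun k _ => ?_
    rw [nambuXiCT_zero_frame, nambuXi]
  rw [hset]
  refine h.trans (le_of_eq ?_)
  have hs : 0 < Real.sqrt (0.15 / 8) := Real.sqrt_pos.2 (by norm_num)
  have hπ := Real.pi_pos
  field_simp
  ring

/-- **At the bare frame the scale-`0` infrared Gram constant is `≤ 1` once `2¹⁰β² ≤ L`** (`40/(32π²√(0.15/8)) ≤ 0.93`, rounding terms `≤ 10⁻⁴`):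
`μ ∈ klWindowC`, `klBetaMin ≤ β`, `2¹⁰·β² ≤ L`, every `M`. -/
theorem infraredGram_free_scaleZero_le_one {M : ℕ} {μ : ℝ} (hμ : μ ∈ klWindowC) {β : ℝ} (hβ : klBetaMin ≤ β)
    (hL : (2 : ℝ) ^ 10 * β ^ 2 ≤ L) :
    1 / (β * (L : ℝ) ^ 2) * ∑ k : FreqMomentum L M,
      (1 - hubbardCutoffWeightCT L M β μ 0 klE0 k) / Real.sqrt (matsubaraFreq β M k.1 ^ 2 + nambuXiCT L μ 0 k.2 ^ 2) ≤ 1 := by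
  have h128 : (128 : ℝ) ≤ β := by simpa [klBetaMin] using hβ
  have hβpos : 0 < β := by linarith
  have hLpos : (0 : ℝ) < L := by exact_mod_cast Nat.pos_of_ne_zero (NeZero.ne L)
  have he₀ : (0 : ℝ) < klE0 := by norm_num [klE0]
  have hπβ : Real.pi / β ≤ klE0 := by
    rw [div_le_iff₀ hβpos, klE0]
    nlinarith [Real.pi_lt_four]
  have hs : 0 < Real.sqrt (0.15 / 8) := Real.sqrt_pos.2 (by norm_num)
  have hc₁ : 0 ≤ 2 / (π * Real.sqrt (0.15 / 8)) := by positivity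
  have hsum := sum_one_sub_hubbardCutoffWeightCT_div_sqrt_le_largeVolume (L := L) (M := M) hβpos μ 0 he₀ hπβ hc₁
    (by norm_num : (0 : ℝ) ≤ 4) fun η hη hηΛ => card_freeLevel_lt_le_sharp hμ hη hηΛ
  have hβL2 : 0 < β * (L : ℝ) ^ 2 := by positivity
  rw [one_div, inv_mul_le_iff₀ hβL2]
  refine hsum.trans ?_
  -- numerics: `q = π⁻¹ ≤ 0.31831`, `1/√(0.15/8) ≤ 7.31` (`0.1369² ≤ 0.01875`)
  set q : ℝ := Real.pi⁻¹ with hq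
  have hπ := Real.pi_gt_d6
  have hq0 : 0 < q := by rw [hq]; exact inv_pos.2 Real.pi_pos
  have hq1 : q ≤ 0.31831 := by
    rw [hq, inv_le_comm₀ Real.pi_pos (by norm_num)]
    have : (1 : ℝ) / 0.31831 ≤ 3.141592 := by norm_num
    rw [one_div] at this
    linarith
  set r : ℝ := (Real.sqrt (0.15 / 8))⁻¹ with hr
  have hr0 : 0 < r := by rw [hr]; exact inv_pos.2 hs
  have hr1 : r ≤ 7.31 := by
    rw [hr, inv_le_comm₀ hs (by norm_num)]
    have h1 : (0.1369 : ℝ) ≤ Real.sqrt (0.15 / 8) := by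
      rw [show (0.1369 : ℝ) = Real.sqrt (0.1369 ^ 2) by rw [Real.sqrt_sq (by norm_num)]]
      exact Real.sqrt_le_sqrt (by norm_num)
    have : (1 : ℝ) / 7.31 ≤ 0.1369 := by norm_num
    rw [one_div] at this
    linarith
  have e1 : 20 / Real.pi * (2 / (π * Real.sqrt (0.15 / 8))) * klE0 * β * (L : ℝ) ^ 2 +
        8 / Real.pi ^ 2 * 4 * klE0 * β ^ 2 * L + 24 / Real.pi * 4 * β * L =
      (40 / 32) * (q ^ 2 * r) * (β * (L : ℝ) ^ 2) + (32 / 32) * q ^ 2 * β * (β * L) + 96 * q * (β * L) := by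
    simp only [hq, hr, klE0, div_eq_mul_inv, mul_inv]
    ring
  rw [e1]
  have hqr : q ^ 2 * r ≤ 0.31831 ^ 2 * 7.31 := by
    have hq2 : q ^ 2 ≤ 0.31831 ^ 2 := pow_le_pow_left₀ hq0.le hq1 2
    exact mul_le_mul hq2 hr1 hr0.le (by positivity)
  have c1 : (40 / 32 : ℝ) * (q ^ 2 * r) ≤ 0.93 := by nlinarith
  have c2 : (32 / 32 : ℝ) * q ^ 2 ≤ 0.102 := by nlinarith
  have c3 : (96 : ℝ) * q ≤ 30.6 := by nlinarith
  have hβL : 0 < β * (L : ℝ) := by positivity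
  have t1 : (40 / 32 : ℝ) * (q ^ 2 * r) * (β * (L : ℝ) ^ 2) ≤ 0.93 * (β * (L : ℝ) ^ 2) :=
    mul_le_mul_of_nonneg_right c1 hβL2.le
  have t2 : (32 / 32 : ℝ) * q ^ 2 * β * (β * L) ≤ 0.102 * β * (β * L) := by
    have := mul_le_mul_of_nonneg_right c2 (mul_nonneg hβpos.le hβL.le)
    nlinarith
  have t3 : (96 : ℝ) * q * (β * L) ≤ 30.6 * (β * L) := mul_le_mul_of_nonneg_right c3 hβL.le
  have hslack : 0.102 * β * (β * L) + 30.6 * (β * L) ≤ 0.07 * (β * (L : ℝ) ^ 2) := by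
    have h1 : 0.102 * β + 30.6 ≤ 0.07 * (L : ℝ) := by nlinarith
    have h2 : 0.102 * β * (β * L) + 30.6 * (β * L) = (0.102 * β + 30.6) * (β * L) := by ring
    have h3 : 0.07 * (β * (L : ℝ) ^ 2) = (0.07 * L) * (β * L) := by ring
    rw [h2, h3]
    exact mul_le_mul_of_nonneg_right h1 hβL.le
  linarith

section BareFrameSharp

variable {M : ℕ} [NeZero M]

/-- **At the bare frame the scale-`0` covariance is determinant-bounded with `δ₀ = √(2·(7+1)) = 4` on the window**: `μ ∈ klWindowC`, `klBetaMin ≤ β`,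
`2¹⁰β² ≤ L`, every Matsubara cutoff `M ≥ 1`. -/
theorem isDetBoundedR_scaleZero_free_sharp {μ : ℝ} (hμ : μ ∈ klWindowC) {β : ℝ} (hβ : klBetaMin ≤ β) (hL : (2 : ℝ) ^ 10 * β ^ 2 ≤ L) :
    IsDetBoundedR (fun X : GridLeg (GridPoint L (2 * (2 * M))) => decide (X.2 = 0))
      ((hubbardGridSub L M β (2 * (2 * M))).transpose * hubbardCovAboveCT L M β μ 0 0 klE0 *
        hubbardGridSub L M β (2 * (2 * M)))
      (Real.sqrt (2 * (7 + 1))) := by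
  have hβpos : 0 < β := lt_of_lt_of_le (by norm_num [klBetaMin]) hβ
  have hκ : 1 / (β * (L : ℝ) ^ 2) * ∑ k : FreqMomentum L M,
      (1 - hubbardCutoffWeightCT L M β μ 0 klE0 k) / Real.sqrt (matsubaraFreq β M k.1 ^ 2 + nambuXiCT L μ 0 k.2 ^ 2) ≤
        (Real.sqrt 1) ^ 2 := by
    rw [Real.sq_sqrt (by norm_num)]
    exact infraredGram_free_scaleZero_le_one (L := L) (M := M) hμ hβ hL
  have h := isDetBoundedR_gridSub_hubbardCovAboveCT (L := L) (M := M) hβpos μ 0 klE0 hκ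
  rwa [Real.sq_sqrt (by norm_num)] at h

/-- **Replica-Gram form**: `IsGramBoundedR (Sᵀ·C⁰_{>e₀}·S) √(2·(7+1))` at the bare frame on the window, `2¹⁰β² ≤ L`, every `M ≥ 1`. -/
theorem isGramBoundedR_scaleZero_free_sharp {μ : ℝ} (hμ : μ ∈ klWindowC) {β : ℝ} (hβ : klBetaMin ≤ β) (hL : (2 : ℝ) ^ 10 * β ^ 2 ≤ L) :
    IsGramBoundedR
      ((hubbardGridSub L M β (2 * (2 * M))).transpose * hubbardCovAboveCT L M β μ 0 0 klE0 *
        hubbardGridSub L M β (2 * (2 * M)))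
      (Real.sqrt (2 * (7 + 1))) :=
  (isDetBoundedR_scaleZero_free_sharp (L := L) hμ hβ hL).isGramBoundedR
    (fun _ _ h => EngineV8.gridSub_hubbardCovAboveCT_apply_of_charge_eq β μ 0 klE0 (2 * (2 * M)) h) (Real.sqrt_nonneg _)

/-- **`δ₀ = 4` at the bare frame under the stub binder `klEngL₃ β U ≤ L`.** -/
theorem isDetBoundedR_scaleZero_free_sharp_klEngL₃ {μ : ℝ} (hμ : μ ∈ klWindowC) {β U : ℝ} (hβ : klBetaMin ≤ β)
    (hL : EngineV8.klEngL₃ β U ≤ L) :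
    IsDetBoundedR (fun X : GridLeg (GridPoint L (2 * (2 * M))) => decide (X.2 = 0))
      ((hubbardGridSub L M β (2 * (2 * M))).transpose * hubbardCovAboveCT L M β μ 0 0 klE0 *
        hubbardGridSub L M β (2 * (2 * M)))
      (Real.sqrt (2 * (7 + 1))) :=
  isDetBoundedR_scaleZero_free_sharp hμ hβ (sq_le_of_klEngL₃_le hL)

/-- **Replica-Gram form under `klEngL₃ β U ≤ L`.** -/
theorem isGramBoundedR_scaleZero_free_sharp_klEngL₃ {μ : ℝ} (hμ : μ ∈ klWindowC) {β U : ℝ} (hβ : klBetaMin ≤ β)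
    (hL : EngineV8.klEngL₃ β U ≤ L) :
    IsGramBoundedR
      ((hubbardGridSub L M β (2 * (2 * M))).transpose * hubbardCovAboveCT L M β μ 0 0 klE0 *
        hubbardGridSub L M β (2 * (2 * M)))
      (Real.sqrt (2 * (7 + 1))) :=
  isGramBoundedR_scaleZero_free_sharp hμ hβ (sq_le_of_klEngL₃_le hL)

end BareFrameSharp

end Summit.HubbardSuperconductivity.HubbardSuperconductivity.Theorems.KLRegimeSplit

end
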